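import Summits.ValiantsHypothesis.ValiantsHypothesis.Theorems.SymPencilPerFourInnerRankSlotAPoint
import Summits.ValiantsHypothesis.ValiantsHypothesis.Theorems.SymPencilPerFourInnerRankGenericAlt
import Summits.ValiantsHypothesis.ValiantsHypothesis.Theorems.SymPencilPerFourInnerRankMixedKillTwo
import Summits.ValiantsHypothesis.ValiantsHypothesis.Theorems.SymPencilPerFourInnerRankMixedKill
import Summits.ValiantsHypothesis.ValiantsHypothesis.Theorems.SymPencilPerFourInnerRankSlotALinePoly

/-!
# Route `SymPencil` — inner rank of the `2 | 2` row split of `per_4`: the `a`-slot of a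
# `≤ 11`-square joint family is one-sided of rank `≤ 1` (`--supports` stmt-ValiantsHypothesis-5674
# `SdcSuperquadratic`; (8,8) column, isotropic-kernel route, bridge step (B3) of memo
# `NOTE-p6g15-5674-IR12-reduction.md` §8)

**Theorem** (`slotA_rank_le_one`).  For `Σ_r c_r t_r((a,b),(y₂,y₃))² = per (a; b; y₂; y₃)` in
characteristic zero with `|ι| ≤ 11` squares and non-zero weights: EITHER for every `a` all `2 × 2`
minors of the `y₂`-block `y₂ ↦ (t_r((a,0),(y₂,0)))_r` vanish, OR for every `a` those of the
`y₃`-block do.  Proof: `SlotAPoint.shapes_at` gives at every `a` with `∏ a_i ≠ 0` one of six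
systems of polynomial identities; times `∏ a_i` they cover all `a`; `GenericAlt.exists_forall_vanish`
makes one system hold for every `a`; the mixed systems are refuted by `MixedKill.false_of_mixedI`,
`MixedKillTwo.cols_of_typeII` + `false_of_mixedII` (mirrors through the `y₂ ↔ y₃`-swapped design).
Honest framing: a CONDITIONAL reduction step towards the cells `(8,8,10)`, `(8,8,11)`; no cell
closes; the window `27 ≤ sdc(per_4) ≤ 29`, the crux and `VP ≠ VNP` are untouched.  No
definitions, no named facts. [folklore]
-/

noncomputable section

-- single-conjunct layout: Sub = Summit, duplicated namespace component intended
set_option linter.dupNamespace false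

namespace Summit.ValiantsHypothesis.ValiantsHypothesis.Theorems.SymPencilPerFourInnerRankSlotA

open Matrix Finset Module Polynomial
open Summit.ValiantsHypothesis.ValiantsHypothesis.Theorems.SymPencilPerFourPairingDiscTools
open Summit.ValiantsHypothesis.ValiantsHypothesis.Theorems.SymPencilPerFourHessianMinors
open Summit.ValiantsHypothesis.ValiantsHypothesis.Theorems.SymPencilPerFourHessianRankThreeZero
open Summit.ValiantsHypothesis.ValiantsHypothesis.Theorems.SymPencilPerFourInnerRankGenericAlt
open Summit.ValiantsHypothesis.ValiantsHypothesis.Theorems.SymPencilPerFourInnerRankMixedKill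
open Summit.ValiantsHypothesis.ValiantsHypothesis.Theorems.SymPencilPerFourInnerRankMixedKillTwo
open Summit.ValiantsHypothesis.ValiantsHypothesis.Theorems.SymPencilPerFourInnerRankSlotAShapes
open Summit.ValiantsHypothesis.ValiantsHypothesis.Theorems.SymPencilPerFourInnerRankSlotAPoint
open Summit.ValiantsHypothesis.ValiantsHypothesis.Theorems.SymPencilPerFourInnerRankSlotALinePoly

variable {K : Type*} [Field K] {ι : Type*} [Fintype ι]

/-- **The `a`-slot of a `≤ 11`-square joint family is one-sided of rank `≤ 1`.**  See the module
docstring. [folklore] -/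
theorem slotA_rank_le_one [CharZero K] [DecidableEq ι] (hι : Fintype.card ι ≤ 11)
    (c : ι → K) (hc : ∀ r, c r ≠ 0)
    (t : ι → (((Fin 4 → K) × (Fin 4 → K)) →ₗ[K] ((Fin 4 → K) × (Fin 4 → K)) →ₗ[K] K))
    (hJ : ∀ a b y₂ y₃ : Fin 4 → K,
      ∑ r, c r * (t r (a, b) (y₂, y₃)) ^ 2 = (Matrix.of ![a, b, y₂, y₃]).permanent) :
    (∀ (a x x' : Fin 4 → K) (r r' : ι),
      t r (a, 0) (x, 0) * t r' (a, 0) (x', 0) - t r (a, 0) (x', 0) * t r' (a, 0) (x, 0) = 0) ∨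
    (∀ (a x x' : Fin 4 → K) (r r' : ι),
      t r (a, 0) (0, x) * t r' (a, 0) (0, x') - t r (a, 0) (0, x') * t r' (a, 0) (0, x) = 0) := by
  classical
  -- the six systems (times `∏ a_i`); junk index data ↦ the constant function `1`
  let Pr : (Fin 4 → K) → K := fun a => ∏ i, a i
  let dist : Fin 4 → Fin 4 → Fin 4 → Fin 4 → Prop := fun k l p q =>
    k ≠ l ∧ k ≠ p ∧ k ≠ q ∧ l ≠ p ∧ l ≠ q ∧ p ≠ q
  let gI₁ : Fin 4 → Fin 4 → (Fin 4 → K) → (Fin 4 → K) := fun k l a =>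
    a k • Pi.single k 1 + a l • Pi.single l 1
  let gI₃ : Fin 4 → Fin 4 → (Fin 4 → K) → (Fin 4 → K) := fun k l a =>
    a k • Pi.single k 1 - a l • Pi.single l 1
  let gII₃ : Fin 4 → Fin 4 → Fin 4 → Fin 4 → (Fin 4 → K) → (Fin 4 → K) := fun d p q k a =>
    a p • Pi.single p 1 + a q • Pi.single q 1 + a k • Pi.single k 1 - a d • Pi.single d 1
  let F : Fin 6 × Fin 4 × Fin 4 × Fin 4 × Fin 4 → Set ((Fin 4 → K) → K) := fun α =>
    match α with
    | (0, _) => Set.range fun w : (Fin 4 → K) × (Fin 4 → K) × ι × ι => fun a =>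
        (t w.2.2.1 (a, 0) (w.1, 0) * t w.2.2.2 (a, 0) (w.2.1, 0)
          - t w.2.2.1 (a, 0) (w.2.1, 0) * t w.2.2.2 (a, 0) (w.1, 0)) * Pr a
    | (1, _) => Set.range fun w : (Fin 4 → K) × (Fin 4 → K) × ι × ι => fun a =>
        (t w.2.2.1 (a, 0) (0, w.1) * t w.2.2.2 (a, 0) (0, w.2.1)
          - t w.2.2.1 (a, 0) (0, w.2.1) * t w.2.2.2 (a, 0) (0, w.1)) * Pr a
    | (2, k, l, p, q) => if dist k l p q then
        Set.range fun rb : ι × Bool => fun a =>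
          (if rb.2 then t rb.1 (a, 0) (gI₁ k l a, 0) else t rb.1 (a, 0) (0, gI₃ k l a)) * Pr a
        else {fun _ => 1}
    | (3, k, l, p, q) => if dist k l p q then
        Set.range fun rb : ι × Bool => fun a =>
          (if rb.2 then t rb.1 (a, 0) (0, gI₁ k l a) else t rb.1 (a, 0) (gI₃ k l a, 0)) * Pr a
        else {fun _ => 1}
    | (4, d, p, q, k) => if dist d p q k then
        Set.range fun rj : ι × Fin 3 => fun a =>
          (![t rj.1 (a, 0) (gI₃ p q a, 0), t rj.1 (a, 0) (gI₃ q k a, 0),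
             t rj.1 (a, 0) (0, gII₃ d p q k a)] rj.2) * Pr a
        else {fun _ => 1}
    | (5, d, p, q, k) => if dist d p q k then
        Set.range fun rj : ι × Fin 3 => fun a =>
          (![t rj.1 (a, 0) (0, gI₃ p q a), t rj.1 (a, 0) (0, gI₃ q k a),
             t rj.1 (a, 0) (gII₃ d p q k a, 0)] rj.2) * Pr a
        else {fun _ => 1}
  -- the swapped design (for the mirrored patterns)
  set t' : ι → (((Fin 4 → K) × (Fin 4 → K)) →ₗ[K] ((Fin 4 → K) × (Fin 4 → K)) →ₗ[K] K) :=
    fun r => (t r).compl₂ (LinearEquiv.prodComm K (Fin 4 → K) (Fin 4 → K)).toLinearMap with ht'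
  have hJ' : ∀ a b y₂ y₃ : Fin 4 → K,
      ∑ r, c r * (t' r (a, b) (y₂, y₃)) ^ 2 = (Matrix.of ![a, b, y₂, y₃]).permanent :=
    hJ_yswap c t hJ
  have ht'ap : ∀ r (u y : (Fin 4 → K) × (Fin 4 → K)), t' r u y = t r u (y.2, y.1) :=
    fun r u y => by simp [ht', Prod.swap]
  -- additivity / homogeneity of the generator maps
  have gI₁_add : ∀ k l x y, gI₁ k l (x + y) = gI₁ k l x + gI₁ k l y := fun k l x y => by
    simp only [gI₁, Pi.add_apply, add_smul]; abel
  have gI₁_smul : ∀ k l (s : K) x, gI₁ k l (s • x) = s • gI₁ k l x := fun k l s x => by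
    simp only [gI₁, Pi.smul_apply, smul_eq_mul, smul_add, smul_smul]
  have gI₃_add : ∀ k l x y, gI₃ k l (x + y) = gI₃ k l x + gI₃ k l y := fun k l x y => by
    simp only [gI₃, Pi.add_apply, add_smul]; abel
  have gI₃_smul : ∀ k l (s : K) x, gI₃ k l (s • x) = s • gI₃ k l x := fun k l s x => by
    simp only [gI₃, Pi.smul_apply, smul_eq_mul, smul_sub, smul_smul]
  have gII₃_add : ∀ d p q k x y, gII₃ d p q k (x + y) = gII₃ d p q k x + gII₃ d p q k y :=
    fun d p q k x y => by simp only [gII₃, Pi.add_apply, add_smul]; abel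
  have gII₃_smul : ∀ d p q k (s : K) x, gII₃ d p q k (s • x) = s • gII₃ d p q k x :=
    fun d p q k s x => by simp only [gII₃, Pi.smul_apply, smul_eq_mul, smul_add, smul_sub, smul_smul]
  -- line-polynomiality of the building blocks
  have lp_fst : ∀ k l r, ∀ y₀ y : Fin 4 → K, ∃ P : K[X], ∀ s : K,
      (fun a : Fin 4 → K => t r (a, 0) (gI₁ k l a, 0)) (y₀ + s • y) = P.eval s := fun k l r =>
    linePoly_slot_quad t r (fun a => (gI₁ k l a, 0))
      (fun x y => by rw [gI₁_add, Prod.mk_add_mk, add_zero])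
      (fun s x => by rw [gI₁_smul, Prod.smul_mk, smul_zero])
  have lp_fst₃ : ∀ k l r, ∀ y₀ y : Fin 4 → K, ∃ P : K[X], ∀ s : K,
      (fun a : Fin 4 → K => t r (a, 0) (gI₃ k l a, 0)) (y₀ + s • y) = P.eval s := fun k l r =>
    linePoly_slot_quad t r (fun a => (gI₃ k l a, 0))
      (fun x y => by rw [gI₃_add, Prod.mk_add_mk, add_zero])
      (fun s x => by rw [gI₃_smul, Prod.smul_mk, smul_zero])
  have lp_snd : ∀ k l r, ∀ y₀ y : Fin 4 → K, ∃ P : K[X], ∀ s : K,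
      (fun a : Fin 4 → K => t r (a, 0) (0, gI₁ k l a)) (y₀ + s • y) = P.eval s := fun k l r =>
    linePoly_slot_quad t r (fun a => (0, gI₁ k l a))
      (fun x y => by rw [gI₁_add, Prod.mk_add_mk, add_zero])
      (fun s x => by rw [gI₁_smul, Prod.smul_mk, smul_zero])
  have lp_snd₃ : ∀ k l r, ∀ y₀ y : Fin 4 → K, ∃ P : K[X], ∀ s : K,
      (fun a : Fin 4 → K => t r (a, 0) (0, gI₃ k l a)) (y₀ + s • y) = P.eval s := fun k l r =>
    linePoly_slot_quad t r (fun a => (0, gI₃ k l a))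
      (fun x y => by rw [gI₃_add, Prod.mk_add_mk, add_zero])
      (fun s x => by rw [gI₃_smul, Prod.smul_mk, smul_zero])
  have lp_II_fst : ∀ d p q k r, ∀ y₀ y : Fin 4 → K, ∃ P : K[X], ∀ s : K,
      (fun a : Fin 4 → K => t r (a, 0) (gII₃ d p q k a, 0)) (y₀ + s • y) = P.eval s :=
    fun d p q k r => linePoly_slot_quad t r (fun a => (gII₃ d p q k a, 0))
      (fun x y => by rw [gII₃_add, Prod.mk_add_mk, add_zero])
      (fun s x => by rw [gII₃_smul, Prod.smul_mk, smul_zero])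
  have lp_II_snd : ∀ d p q k r, ∀ y₀ y : Fin 4 → K, ∃ P : K[X], ∀ s : K,
      (fun a : Fin 4 → K => t r (a, 0) (0, gII₃ d p q k a)) (y₀ + s • y) = P.eval s :=
    fun d p q k r => linePoly_slot_quad t r (fun a => (0, gII₃ d p q k a))
      (fun x y => by rw [gII₃_add, Prod.mk_add_mk, add_zero])
      (fun s x => by rw [gII₃_smul, Prod.smul_mk, smul_zero])
  have lp_min₂ : ∀ (x x' : Fin 4 → K) (r r' : ι), ∀ y₀ y : Fin 4 → K, ∃ P : K[X], ∀ s : K,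
      (fun a : Fin 4 → K => t r (a, 0) (x, 0) * t r' (a, 0) (x', 0)
        - t r (a, 0) (x', 0) * t r' (a, 0) (x, 0)) (y₀ + s • y) = P.eval s := fun x x' r r' =>
    linePoly_sub (f := fun a => t r (a, 0) (x, 0) * t r' (a, 0) (x', 0))
      (g := fun a => t r (a, 0) (x', 0) * t r' (a, 0) (x, 0))
      (linePoly_mul (f := fun a => t r (a, 0) (x, 0)) (g := fun a => t r' (a, 0) (x', 0))
        (linePoly_slot t r (x, 0)) (linePoly_slot t r' (x', 0)))
      (linePoly_mul (f := fun a => t r (a, 0) (x', 0)) (g := fun a => t r' (a, 0) (x, 0))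
        (linePoly_slot t r (x', 0)) (linePoly_slot t r' (x, 0)))
  have lp_min₃ : ∀ (x x' : Fin 4 → K) (r r' : ι), ∀ y₀ y : Fin 4 → K, ∃ P : K[X], ∀ s : K,
      (fun a : Fin 4 → K => t r (a, 0) (0, x) * t r' (a, 0) (0, x')
        - t r (a, 0) (0, x') * t r' (a, 0) (0, x)) (y₀ + s • y) = P.eval s := fun x x' r r' =>
    linePoly_sub (f := fun a => t r (a, 0) (0, x) * t r' (a, 0) (0, x'))
      (g := fun a => t r (a, 0) (0, x') * t r' (a, 0) (0, x))
      (linePoly_mul (f := fun a => t r (a, 0) (0, x)) (g := fun a => t r' (a, 0) (0, x'))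
        (linePoly_slot t r (0, x)) (linePoly_slot t r' (0, x')))
      (linePoly_mul (f := fun a => t r (a, 0) (0, x')) (g := fun a => t r' (a, 0) (0, x))
        (linePoly_slot t r (0, x')) (linePoly_slot t r' (0, x)))
  have lp_one : ∀ y₀ y : Fin 4 → K, ∃ P : K[X], ∀ s : K,
      (fun _ : Fin 4 → K => (1 : K)) (y₀ + s • y) = P.eval s := fun y₀ y => linePoly_const 1 y₀ y
  have lpPr : ∀ y₀ y : Fin 4 → K, ∃ P : K[X], ∀ s : K, Pr (y₀ + s • y) = P.eval s :=
    linePoly_coordProd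
  -- every member of every system is polynomial along lines
  have hF : ∀ α, ∀ f ∈ F α, ∀ y₀ y : Fin 4 → K, ∃ P : K[X], ∀ s : K, f (y₀ + s • y) = P.eval s := by
    rintro ⟨s, k, l, p, q⟩ f hf
    fin_cases s
    · simp only [F] at hf
      obtain ⟨⟨x, x', r, r'⟩, rfl⟩ := hf
      exact linePoly_mul (f := fun a => t r (a, 0) (x, 0) * t r' (a, 0) (x', 0)
          - t r (a, 0) (x', 0) * t r' (a, 0) (x, 0)) (g := Pr) (lp_min₂ x x' r r') lpPr
    · simp only [F] at hf
      obtain ⟨⟨x, x', r, r'⟩, rfl⟩ := hf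
      exact linePoly_mul (f := fun a => t r (a, 0) (0, x) * t r' (a, 0) (0, x')
          - t r (a, 0) (0, x') * t r' (a, 0) (0, x)) (g := Pr) (lp_min₃ x x' r r') lpPr
    · simp only [F] at hf
      by_cases hd : dist k l p q
      · rw [if_pos hd] at hf
        obtain ⟨⟨r, b⟩, rfl⟩ := hf
        cases b
        · simpa using linePoly_mul (f := fun a => t r (a, 0) (0, gI₃ k l a)) (g := Pr) (lp_snd₃ k l r) lpPr
        · simpa using linePoly_mul (f := fun a => t r (a, 0) (gI₁ k l a, 0)) (g := Pr) (lp_fst k l r) lpPr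
      · rw [if_neg hd] at hf
        rw [Set.mem_singleton_iff.1 hf]; exact lp_one
    · simp only [F] at hf
      by_cases hd : dist k l p q
      · rw [if_pos hd] at hf
        obtain ⟨⟨r, b⟩, rfl⟩ := hf
        cases b
        · simpa using linePoly_mul (f := fun a => t r (a, 0) (gI₃ k l a, 0)) (g := Pr) (lp_fst₃ k l r) lpPr
        · simpa using linePoly_mul (f := fun a => t r (a, 0) (0, gI₁ k l a)) (g := Pr) (lp_snd k l r) lpPr
      · rw [if_neg hd] at hf
        rw [Set.mem_singleton_iff.1 hf]; exact lp_one
    · simp only [F] at hf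
      by_cases hd : dist k l p q
      · rw [if_pos hd] at hf
        obtain ⟨⟨r, j⟩, rfl⟩ := hf
        fin_cases j
        · simpa using linePoly_mul (f := fun a => t r (a, 0) (gI₃ l p a, 0)) (g := Pr) (lp_fst₃ l p r) lpPr
        · simpa using linePoly_mul (f := fun a => t r (a, 0) (gI₃ p q a, 0)) (g := Pr) (lp_fst₃ p q r) lpPr
        · simpa using linePoly_mul (f := fun a => t r (a, 0) (0, gII₃ k l p q a)) (g := Pr) (lp_II_snd k l p q r) lpPr
      · rw [if_neg hd] at hf
        rw [Set.mem_singleton_iff.1 hf]; exact lp_one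
    · simp only [F] at hf
      by_cases hd : dist k l p q
      · rw [if_pos hd] at hf
        obtain ⟨⟨r, j⟩, rfl⟩ := hf
        fin_cases j
        · simpa using linePoly_mul (f := fun a => t r (a, 0) (0, gI₃ l p a)) (g := Pr) (lp_snd₃ l p r) lpPr
        · simpa using linePoly_mul (f := fun a => t r (a, 0) (0, gI₃ p q a)) (g := Pr) (lp_snd₃ p q r) lpPr
        · simpa using linePoly_mul (f := fun a => t r (a, 0) (gII₃ k l p q a, 0)) (g := Pr) (lp_II_fst k l p q r) lpPr
      · rw [if_neg hd] at hf
        rw [Set.mem_singleton_iff.1 hf]; exact lp_one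
  -- at every `a`, one system vanishes
  have hcover : ∀ a ∈ (⊤ : Submodule K (Fin 4 → K)), ∃ α, ∀ f ∈ F α, f a = 0 := by
    intro a _
    by_cases hPr : Pr a = 0
    · refine ⟨(0, 0, 0, 0, 0), fun f hf => ?_⟩
      simp only [F] at hf
      obtain ⟨w, rfl⟩ := hf
      simp only [hPr, mul_zero]
    · have ha : ∀ i, a i ≠ 0 := fun i hi => hPr (Finset.prod_eq_zero (Finset.mem_univ i) hi)
      rcases shapes_at hι c hc t hJ a ha with h | h | ⟨k, l, p, q, hkl, hkp, hkq, hlp, hlq, hpq, h⟩ |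
          ⟨k, l, p, q, hkl, hkp, hkq, hlp, hlq, hpq, h⟩ | ⟨d, p, q, k, hdp, hdq, hdk, hpq, hpk, hqk, h⟩ |
          ⟨d, p, q, k, hdp, hdq, hdk, hpq, hpk, hqk, h⟩
      · refine ⟨(0, 0, 0, 0, 0), fun f hf => ?_⟩
        simp only [F] at hf
        obtain ⟨⟨x, x', r, r'⟩, rfl⟩ := hf
        simp only [h x x' r r', zero_mul]
      · refine ⟨(1, 0, 0, 0, 0), fun f hf => ?_⟩
        simp only [F] at hf
        obtain ⟨⟨x, x', r, r'⟩, rfl⟩ := hf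
        simp only [h x x' r r', zero_mul]
      · have hd : dist k l p q := ⟨hkl, hkp, hkq, hlp, hlq, hpq⟩
        refine ⟨(2, k, l, p, q), fun f hf => ?_⟩
        simp only [F] at hf
        rw [if_pos hd] at hf
        obtain ⟨⟨r, b⟩, rfl⟩ := hf
        cases b
        · simp only [gI₃]; simp [(h r).2]
        · simp only [gI₁]; simp [(h r).1]
      · have hd : dist k l p q := ⟨hkl, hkp, hkq, hlp, hlq, hpq⟩
        refine ⟨(3, k, l, p, q), fun f hf => ?_⟩
        simp only [F] at hf
        rw [if_pos hd] at hf
        obtain ⟨⟨r, b⟩, rfl⟩ := hf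
        cases b
        · simp only [gI₃]; simp [(h r).2]
        · simp only [gI₁]; simp [(h r).1]
      · have hd : dist d p q k := ⟨hdp, hdq, hdk, hpq, hpk, hqk⟩
        refine ⟨(4, d, p, q, k), fun f hf => ?_⟩
        simp only [F] at hf
        rw [if_pos hd] at hf
        obtain ⟨⟨r, j⟩, rfl⟩ := hf
        fin_cases j
        · simp only [gI₃]; simp [(h r).1]
        · simp only [gI₃]; simp [(h r).2.1]
        · simp only [gII₃]; simp [(h r).2.2]
      · have hd : dist d p q k := ⟨hdp, hdq, hdk, hpq, hpk, hqk⟩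
        refine ⟨(5, d, p, q, k), fun f hf => ?_⟩
        simp only [F] at hf
        rw [if_pos hd] at hf
        obtain ⟨⟨r, j⟩, rfl⟩ := hf
        fin_cases j
        · simp only [gI₃]; simp [(h r).1]
        · simp only [gI₃]; simp [(h r).2.1]
        · simp only [gII₃]; simp [(h r).2.2]
  -- genericity: one system vanishes for every `a`
  obtain ⟨⟨s, k, l, p, q⟩, hα⟩ := exists_forall_vanish ⊤ F hF hcover
  -- the cancelled identities
  have hcanc : ∀ {g : (Fin 4 → K) → K},
      (∀ y₀ y : Fin 4 → K, ∃ P : K[X], ∀ s : K, g (y₀ + s • y) = P.eval s) →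
      (∀ a, g a * Pr a = 0) → ∀ a, g a = 0 := fun hg h => cancel_coordProd hg h
  fin_cases s
  · -- one-sided, `y₂`-block
    left
    intro a x x' r r'
    simp only [F] at hα
    exact hcanc (lp_min₂ x x' r r')
      (fun a => hα a Submodule.mem_top _ ⟨(x, x', r, r'), rfl⟩) a
  · right
    intro a x x' r r'
    simp only [F] at hα
    exact hcanc (lp_min₃ x x' r r')
      (fun a => hα a Submodule.mem_top _ ⟨(x, x', r, r'), rfl⟩) a
  · exfalso
    simp only [F] at hα
    by_cases hd : dist k l p q
    · rw [if_pos hd] at hα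
      obtain ⟨hkl, hkp, hkq, hlp, hlq, hpq⟩ := hd
      have e1 : ∀ (a : Fin 4 → K) r, t r (a, 0) (a k • Pi.single k 1 + a l • Pi.single l 1, 0) = 0 :=
        fun a r => hcanc (lp_fst k l r) (fun a => by
          simpa using hα a Submodule.mem_top _ ⟨(r, true), rfl⟩) a
      have e3 : ∀ (a : Fin 4 → K) r, t r (a, 0) (0, a k • Pi.single k 1 - a l • Pi.single l 1) = 0 :=
        fun a r => hcanc (lp_snd₃ k l r) (fun a => by
          simpa using hα a Submodule.mem_top _ ⟨(r, false), rfl⟩) a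
      exact false_of_mixedI c t hJ p q k l hpq (Ne.symm hkp) (Ne.symm hlp) (Ne.symm hkq)
        (Ne.symm hlq) hkl e1 e3
    · rw [if_neg hd] at hα
      have := hα 0 Submodule.mem_top (fun _ => 1) (Set.mem_singleton _)
      simp at this
  · exfalso
    simp only [F] at hα
    by_cases hd : dist k l p q
    · rw [if_pos hd] at hα
      obtain ⟨hkl, hkp, hkq, hlp, hlq, hpq⟩ := hd
      have e1 : ∀ (a : Fin 4 → K) r, t r (a, 0) (0, a k • Pi.single k 1 + a l • Pi.single l 1) = 0 :=
        fun a r => hcanc (lp_snd k l r) (fun a => by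
          simpa using hα a Submodule.mem_top _ ⟨(r, true), rfl⟩) a
      have e3 : ∀ (a : Fin 4 → K) r, t r (a, 0) (a k • Pi.single k 1 - a l • Pi.single l 1, 0) = 0 :=
        fun a r => hcanc (lp_fst₃ k l r) (fun a => by
          simpa using hα a Submodule.mem_top _ ⟨(r, false), rfl⟩) a
      refine false_of_mixedI c t' hJ' p q k l hpq (Ne.symm hkp) (Ne.symm hlp) (Ne.symm hkq)
        (Ne.symm hlq) hkl (fun a r => ?_) (fun a r => ?_)
      · rw [ht'ap]; exact e1 a r
      · rw [ht'ap]; exact e3 a r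
    · rw [if_neg hd] at hα
      have := hα 0 Submodule.mem_top (fun _ => 1) (Set.mem_singleton _)
      simp at this
  · exfalso
    simp only [F] at hα
    by_cases hd : dist k l p q
    · rw [if_pos hd] at hα
      obtain ⟨hkl, hkp, hkq, hlp, hlq, hpq⟩ := hd
      -- here `(k, l, p, q)` play the roles `(d, p, q, k)` of `shapes_at`
      have e1 : ∀ (a : Fin 4 → K) r, t r (a, 0) (a l • Pi.single l 1 - a p • Pi.single p 1, 0) = 0 :=
        fun a r => hcanc (lp_fst₃ l p r) (fun a => by
          simpa using hα a Submodule.mem_top _ ⟨(r, 0), rfl⟩) a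
      have e2 : ∀ (a : Fin 4 → K) r, t r (a, 0) (a p • Pi.single p 1 - a q • Pi.single q 1, 0) = 0 :=
        fun a r => hcanc (lp_fst₃ p q r) (fun a => by
          simpa using hα a Submodule.mem_top _ ⟨(r, 1), rfl⟩) a
      have e3 : ∀ (a : Fin 4 → K) r, t r (a, 0) (0, a l • Pi.single l 1 + a p • Pi.single p 1
          + a q • Pi.single q 1 - a k • Pi.single k 1) = 0 :=
        fun a r => hcanc (lp_II_snd k l p q r) (fun a => by
          simpa using hα a Submodule.mem_top _ ⟨(r, 2), rfl⟩) a
      have hc' := cols_of_typeII t l p q hlp hlq hpq e1 e2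
      have hcols : ∀ j : Fin 4, j ≠ k → ∀ (a' : Fin 4 → K) r, t r (a', 0) (Pi.single j 1, 0) = 0 :=
        fun j hj => hc' j (by
          rcases eq_or_of_four k l p q hkl hkp hkq hlp hlq hpq j with h | h | h | h
          · exact absurd h hj
          · exact Or.inl h
          · exact Or.inr (Or.inl h)
          · exact Or.inr (Or.inr h))
      refine false_of_mixedII hι c hc t hJ (fun _ => 1) (fun _ => one_ne_zero) k hcols
        ⟨(0, (1 : K) • Pi.single l 1 + (1 : K) • Pi.single p 1 + (1 : K) • Pi.single q 1
          - (1 : K) • Pi.single k 1), ?_, ?_⟩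
      · rw [LinearMap.mem_ker]
        ext r
        simpa using e3 (fun _ => 1) r
      · intro h0
        have := congr_fun h0 k
        simp [Pi.single_eq_of_ne hkl, Pi.single_eq_of_ne hkp, Pi.single_eq_of_ne hkq] at this
    · rw [if_neg hd] at hα
      have := hα 0 Submodule.mem_top (fun _ => 1) (Set.mem_singleton _)
      simp at this
  · exfalso
    simp only [F] at hα
    by_cases hd : dist k l p q
    · rw [if_pos hd] at hα
      obtain ⟨hkl, hkp, hkq, hlp, hlq, hpq⟩ := hd
      have e1 : ∀ (a : Fin 4 → K) r, t r (a, 0) (0, a l • Pi.single l 1 - a p • Pi.single p 1) = 0 :=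
        fun a r => hcanc (lp_snd₃ l p r) (fun a => by
          simpa using hα a Submodule.mem_top _ ⟨(r, 0), rfl⟩) a
      have e2 : ∀ (a : Fin 4 → K) r, t r (a, 0) (0, a p • Pi.single p 1 - a q • Pi.single q 1) = 0 :=
        fun a r => hcanc (lp_snd₃ p q r) (fun a => by
          simpa using hα a Submodule.mem_top _ ⟨(r, 1), rfl⟩) a
      have e3 : ∀ (a : Fin 4 → K) r, t r (a, 0) (a l • Pi.single l 1 + a p • Pi.single p 1
          + a q • Pi.single q 1 - a k • Pi.single k 1, 0) = 0 :=
        fun a r => hcanc (lp_II_fst k l p q r) (fun a => by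
          simpa using hα a Submodule.mem_top _ ⟨(r, 2), rfl⟩) a
      have hc' := cols_of_typeII t' l p q hlp hlq hpq (fun a r => by rw [ht'ap]; exact e1 a r)
        (fun a r => by rw [ht'ap]; exact e2 a r)
      have hcols : ∀ j : Fin 4, j ≠ k → ∀ (a' : Fin 4 → K) r, t' r (a', 0) (Pi.single j 1, 0) = 0 :=
        fun j hj => hc' j (by
          rcases eq_or_of_four k l p q hkl hkp hkq hlp hlq hpq j with h | h | h | h
          · exact absurd h hj
          · exact Or.inl h
          · exact Or.inr (Or.inl h)
          · exact Or.inr (Or.inr h))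
      refine false_of_mixedII hι c hc t' hJ' (fun _ => 1) (fun _ => one_ne_zero) k hcols
        ⟨(0, (1 : K) • Pi.single l 1 + (1 : K) • Pi.single p 1 + (1 : K) • Pi.single q 1
          - (1 : K) • Pi.single k 1), ?_, ?_⟩
      · rw [LinearMap.mem_ker]
        ext r
        have := e3 (fun _ => 1) r
        simpa [ht'ap] using this
      · intro h0
        have := congr_fun h0 k
        simp [Pi.single_eq_of_ne hkl, Pi.single_eq_of_ne hkp, Pi.single_eq_of_ne hkq] at this
    · rw [if_neg hd] at hα
      have := hα 0 Submodule.mem_top (fun _ => 1) (Set.mem_singleton _)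
      simp at this

end Summit.ValiantsHypothesis.ValiantsHypothesis.Theorems.SymPencilPerFourInnerRankSlotA

end
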